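import Summits.AtomisticToContinuum.HydrodynamicLimit.Theorems.OneFlightGossipEngineEnergyCurrentTailsLevelCensusSplitFloorRung0Pathwise
import HarnessLib

/-!
# Rung ½ of the crux `EnergyCurrentTails` (stmt-AtomisticToContinuum-9235, line `level-census-comparison`):
# the pathwise lower bound `stub_pathwiseLower` (stub F of the refutation of `ContactIntensityDomination`)

Helper file (`--supports stmt-AtomisticToContinuum-9235`) discharging the registered stub F
`stub_pathwiseLower` of the rung-½ skeleton, stated exactly as registered.  DETERMINISTIC step (one orbit on the
good set, no probability): for a hard-sphere flow `Φ` on `𝕋³` with `N + 1` spheres of diameter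
`ε = hsDiameter σ N`, a good initial datum `z`, a window `(s, s + κε]` with `ε (1 + 4κ(V + 1)) < 1/2`, and the marks
`Ξ_V(n, v, w) = β(v − Ve₁) β(w + Ve₁)` (`β = (1 − ‖·‖)₊`, `V ≥ 1`; the mark ignores the normal `n`),

  `Σᵢ Σⱼ [i ≠ j] pairTubeMark ε κ Ξ_V i j (Φ_s z)`
    `≤ Σ_{collision times τ ∈ (s, s + κε]} Σᵢ Σⱼ [i ≠ j] 1[contact of (i,j)] φ_V(incoming velocities of (i, j) at τ)`
      `+ Σ_{p ∈ W} #{q ∈ W : q ∉ {p, p.swap}}`                                              (in `ℝ≥0∞`),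

`φ_V(v, w) = Ξ_V(v, w) + Ξ_V(w, v)` the symmetrised mark of `JeansLoadedDice.ContactIntensityDomination` (read at
the incoming velocities `collidePair i j (Φ_τ z)`), `W = wouldBePairs ε (κε) (Φ_s z)` the ordered would-be pairs of
the window.  Chain (the template is `EnergyCurrentTailsLevelCensus.splitFloorRung0_pathwise`):
(1) the static tube sum is at most the would-be marked sum of the window
(`RateFloorWindowFloor.tubeSum_trunc_le_wouldBeSum` with `χ ≡ 1`, `L = V + 1`: `Ξ_V ≠ 0` forces `‖v − Ve₁‖ < 1`,
`‖w + Ve₁‖ < 1`, hence `‖v − w‖ < 2(V + 1)` and `‖v‖ < V + 1 ≤ 2V`);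
(2) the would-be sum exceeds the realised one by at most the number of non-realised would-be pairs (`Ξ_V ≤ 1`,
`wouldBeSum_le_realisedSum_add_card`);
(3) the realised marked sum is at most the window collision functional of the mark
(`RateFloorMarkedTransfer.stub_markedTransfer RateFloorRealisedDatum.stub_realisedDatum`);
(4) the number of non-realised would-be pairs is at most the pair excess (`card_sdiff_realisedPairs_le`);
(5) termwise, at a collision time and an ordered contact pair `(i, j)` the reflected current velocities ARE the
velocities of `collidePair i j (Φ_τ z)` (`collidePair_apply_left/right`), the orbit stays in the hard-sphere domain
(`mem_contactSet`), and `Ξ_V(v, w) ≤ φ_V(v, w)`.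
The helpers are stated for an arbitrary drift vector `a` in place of `Ve₁` (only `‖a‖ ≤ V` matters).

References: Gallagher–Saint-Raymond–Texier 2013 §4.1 (hard-sphere trajectories, collision cylinders);
Cercignani–Illner–Pulvirenti 1994 §2.2; elementary.
-/

noncomputable section

open MeasureTheory Set Filter
open scoped ENNReal InnerProductSpace BigOperators Classical

namespace Summit.AtomisticToContinuum.HydrodynamicLimit.Theorems.EnergyCurrentTailsRungHalf

open Literature.MathematicalPhysics.KineticTheory Literature.Analysis.FluidPDE
open Summit.AtomisticToContinuum.HydrodynamicLimit.Theorems.RateFloorLine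
open Summit.AtomisticToContinuum.HydrodynamicLimit.Theorems.EnergyCurrentTailsLevelCensus

/-! ## The mark `Ξ(v, w) = β(v − a) β(w + a)`: bounds and speed cutoffs -/

/-- `‖V e₁‖ ≤ V` for `V ≥ 0` (in fact equality). [folklore] -/
theorem norm_smul_single_le {V : ℝ} (hV : 0 ≤ V) : ‖V • EuclideanSpace.single (0 : Fin 3) (1 : ℝ)‖ ≤ V := by
  rw [norm_smul, Real.norm_eq_abs, PiLp.norm_single, norm_one, mul_one, abs_of_nonneg hV]

/-- The mark `Ξ(v, w) = β(v − a) β(w + a)` is nonnegative. [folklore] -/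
theorem mark_nonneg (a v w : V3) : 0 ≤ max 0 (1 - ‖v - a‖) * max 0 (1 - ‖w + a‖) :=
  mul_nonneg (le_max_left _ _) (le_max_left _ _)

/-- The mark `Ξ` is at most `1`. [folklore] -/
theorem mark_le_one (a v w : V3) : max 0 (1 - ‖v - a‖) * max 0 (1 - ‖w + a‖) ≤ 1 :=
  mul_le_one₀ (max_le zero_le_one (by linarith [norm_nonneg (v - a)])) (le_max_left _ _)
    (max_le zero_le_one (by linarith [norm_nonneg (w + a)]))

/-- If the mark `Ξ(v, w)` is nonzero then `‖v − a‖ < 1` and `‖w + a‖ < 1`. [folklore] -/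
theorem norm_lt_one_of_mark_ne_zero {a v w : V3} (h : max 0 (1 - ‖v - a‖) * max 0 (1 - ‖w + a‖) ≠ 0) :
    ‖v - a‖ < 1 ∧ ‖w + a‖ < 1 := by
  by_contra hcon
  rcases not_and_or.1 hcon with h1 | h1
  · exact h (by rw [max_eq_left (by linarith [not_lt.1 h1]), zero_mul])
  · exact h (by rw [mul_comm, max_eq_left (by linarith [not_lt.1 h1]), zero_mul])

/-- Relative-speed cutoff: `Ξ(v, w) = 0` once `2(V + 1) ≤ ‖v − w‖` (`‖a‖ ≤ V`). [folklore] -/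
theorem mark_eq_zero_of_relSpeed {a : V3} {V : ℝ} (ha : ‖a‖ ≤ V) {v w : V3} (h : 2 * (V + 1) ≤ ‖v - w‖) :
    max 0 (1 - ‖v - a‖) * max 0 (1 - ‖w + a‖) = 0 := by
  by_contra hne
  obtain ⟨h1, h2⟩ := norm_lt_one_of_mark_ne_zero hne
  have e : v - w = (v - a) - (w + a) + (a + a) := by abel
  have hle : ‖v - w‖ ≤ ‖v - a‖ + ‖w + a‖ + (‖a‖ + ‖a‖) :=
    calc ‖v - w‖ = ‖(v - a) - (w + a) + (a + a)‖ := by rw [← e]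
      _ ≤ ‖(v - a) - (w + a)‖ + ‖a + a‖ := norm_add_le _ _
      _ ≤ ‖v - a‖ + ‖w + a‖ + (‖a‖ + ‖a‖) := add_le_add (norm_sub_le _ _) (norm_add_le _ _)
  linarith

/-- Speed cutoff: `Ξ(v, w) = 0` once `2V ≤ ‖v‖` (`‖a‖ ≤ V`, `V ≥ 1`). [folklore] -/
theorem mark_eq_zero_of_speed {a : V3} {V : ℝ} (ha : ‖a‖ ≤ V) (hV : 1 ≤ V) {v w : V3} (h : 2 * V ≤ ‖v‖) :
    max 0 (1 - ‖v - a‖) * max 0 (1 - ‖w + a‖) = 0 := by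
  by_contra hne
  obtain ⟨h1, -⟩ := norm_lt_one_of_mark_ne_zero hne
  have hle : ‖v‖ ≤ ‖v - a‖ + ‖a‖ :=
    calc ‖v‖ = ‖(v - a) + a‖ := by rw [sub_add_cancel]
      _ ≤ ‖v - a‖ + ‖a‖ := norm_add_le _ _
  linarith

/-! ## The collision functional of `Ξ` is at most the contact functional of `φ = Ξ + Ξ ∘ swap` -/

section Flow

variable {σ : ℝ} {N : ℕ}

/-- **Termwise.**  On the good set, at any time `u` and ordered pair `(i, j)`: the summand
`1[i ≠ j, contact] Ξ(reflected current velocities)` of the window collision functional of the line `Sketch` is at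
most the summand `1[i ≠ j] 1_{contactSet i j} φ(velocities of collidePair i j ·)` of the functional of
`ContactIntensityDomination`: the orbit stays in the hard-sphere domain (`mem_contactSet`), the velocities of
`collidePair i j y` ARE the current ones reflected across the separation vector (`collidePair_apply_left`,
`collidePair_apply_right`), and `Ξ(v, w) ≤ Ξ(v, w) + Ξ(w, v) = φ(v, w)`. [folklore] -/
theorem ofReal_markTerm_le_indicator (Φ : Flow σ N) {z : Config (N + 1) (Fin 3) T3} (hz : z ∈ Φ.good)
    (a : V3) (u : ℝ) (i j : Fin (N + 1)) :
    ENNReal.ofReal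
        (if i ≠ j ∧ ‖(Torus.geometry (Fin 3)).sepVec (Φ.flow u z i).1 (Φ.flow u z j).1‖ = hsDiameter σ N then
          max 0 (1 - ‖(reflectVel ((Torus.geometry (Fin 3)).sepVec (Φ.flow u z i).1 (Φ.flow u z j).1)
              ((Φ.flow u z i).2, (Φ.flow u z j).2)).1 - a‖) *
            max 0 (1 - ‖(reflectVel ((Torus.geometry (Fin 3)).sepVec (Φ.flow u z i).1 (Φ.flow u z j).1)
              ((Φ.flow u z i).2, (Φ.flow u z j).2)).2 + a‖)
        else 0) ≤
      if i = j then (0 : ℝ≥0∞) else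
        (contactSet (Torus.geometry (Fin 3)) (N + 1) (hsDiameter σ N) i j).indicator
          (fun y => ENNReal.ofReal
            (max 0 (1 - ‖((collidePair (Torus.geometry (Fin 3)) i j y) i).2 - a‖) *
                max 0 (1 - ‖((collidePair (Torus.geometry (Fin 3)) i j y) j).2 + a‖) +
              max 0 (1 - ‖((collidePair (Torus.geometry (Fin 3)) i j y) j).2 - a‖) *
                max 0 (1 - ‖((collidePair (Torus.geometry (Fin 3)) i j y) i).2 + a‖)))
          (Φ.flow u z) := by
  by_cases hij : i = j
  · rw [if_neg (fun h => h.1 hij), if_pos hij, ENNReal.ofReal_zero]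
  rw [if_neg hij]
  by_cases hc : ‖(Torus.geometry (Fin 3)).sepVec (Φ.flow u z i).1 (Φ.flow u z j).1‖ = hsDiameter σ N
  · have hmem : Φ.flow u z ∈ contactSet (Torus.geometry (Fin 3)) (N + 1) (hsDiameter σ N) i j :=
      mem_contactSet.2 ⟨(Φ.isTrajectory z hz).mem u, hc⟩
    rw [if_pos ⟨hij, hc⟩, Set.indicator_of_mem hmem, collidePair_apply_left hij, collidePair_apply_right]
    exact ENNReal.ofReal_le_ofReal (le_add_of_nonneg_right (mark_nonneg a _ _))
  · rw [if_neg (fun h => hc h.2), ENNReal.ofReal_zero]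
    exact bot_le

/-- **Window by window.**  On the good set, the window collision functional of the mark `Ξ` (the right-hand side
of the marked transfer of the line `Sketch`, a real `finsum` over the finitely many collision times of the window) is
at most the `ℝ≥0∞`-valued contact functional of `φ` of `ContactIntensityDomination` over the same window
(`ofReal_markTerm_le_indicator` under `finsum_mem_eq_finite_toFinset_sum`, `ENNReal.ofReal_sum_of_nonneg`).
[folklore] -/
theorem ofReal_collisionFunctional_le_contactFunctional (Φ : Flow σ N) {z : Config (N + 1) (Fin 3) T3}
    (hz : z ∈ Φ.good) (a : V3) (s t : ℝ) :
    ENNReal.ofReal (∑ᶠ (u : ℝ) (_ : u ∈ collisionTimes (Torus.geometry (Fin 3)) (hsDiameter σ N)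
        (fun t => Φ.flow t z) ∩ Set.Ioc s t), ∑ i : Fin (N + 1), ∑ j : Fin (N + 1),
          (if i ≠ j ∧ ‖(Torus.geometry (Fin 3)).sepVec (Φ.flow u z i).1 (Φ.flow u z j).1‖ = hsDiameter σ N then
            max 0 (1 - ‖(reflectVel ((Torus.geometry (Fin 3)).sepVec (Φ.flow u z i).1 (Φ.flow u z j).1)
                ((Φ.flow u z i).2, (Φ.flow u z j).2)).1 - a‖) *
              max 0 (1 - ‖(reflectVel ((Torus.geometry (Fin 3)).sepVec (Φ.flow u z i).1 (Φ.flow u z j).1)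
                ((Φ.flow u z i).2, (Φ.flow u z j).2)).2 + a‖)
          else 0)) ≤
      ∑ᶠ τ ∈ collisionTimes (Torus.geometry (Fin 3)) (hsDiameter σ N) (fun r => Φ.flow r z) ∩ Set.Ioc s t,
        ∑ i : Fin (N + 1), ∑ j : Fin (N + 1),
          if i = j then (0 : ℝ≥0∞) else
            (contactSet (Torus.geometry (Fin 3)) (N + 1) (hsDiameter σ N) i j).indicator
              (fun y => ENNReal.ofReal
                (max 0 (1 - ‖((collidePair (Torus.geometry (Fin 3)) i j y) i).2 - a‖) *
                    max 0 (1 - ‖((collidePair (Torus.geometry (Fin 3)) i j y) j).2 + a‖) +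
                  max 0 (1 - ‖((collidePair (Torus.geometry (Fin 3)) i j y) j).2 - a‖) *
                    max 0 (1 - ‖((collidePair (Torus.geometry (Fin 3)) i j y) i).2 + a‖)))
              (Φ.flow τ z) := by
  have htraj := Φ.isTrajectory z hz
  have hfin : (collisionTimes (Torus.geometry (Fin 3)) (hsDiameter σ N) (fun t => Φ.flow t z) ∩ Set.Ioc s t).Finite :=
    htraj.finite_collisionTimes_inter_of_subset_Icc Set.Ioc_subset_Icc_self
  have hnn0 : ∀ (u : ℝ) (i j : Fin (N + 1)), 0 ≤
      (if i ≠ j ∧ ‖(Torus.geometry (Fin 3)).sepVec (Φ.flow u z i).1 (Φ.flow u z j).1‖ = hsDiameter σ N then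
        max 0 (1 - ‖(reflectVel ((Torus.geometry (Fin 3)).sepVec (Φ.flow u z i).1 (Φ.flow u z j).1)
            ((Φ.flow u z i).2, (Φ.flow u z j).2)).1 - a‖) *
          max 0 (1 - ‖(reflectVel ((Torus.geometry (Fin 3)).sepVec (Φ.flow u z i).1 (Φ.flow u z j).1)
            ((Φ.flow u z i).2, (Φ.flow u z j).2)).2 + a‖)
      else 0) := fun u i j => by
    split_ifs <;> [exact mark_nonneg a _ _; exact le_rfl]
  rw [finsum_mem_eq_finite_toFinset_sum _ hfin, finsum_mem_eq_finite_toFinset_sum _ hfin,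
    ENNReal.ofReal_sum_of_nonneg fun u _ => Finset.sum_nonneg fun i _ => Finset.sum_nonneg fun j _ => hnn0 u i j]
  refine Finset.sum_le_sum fun u _ => ?_
  rw [ENNReal.ofReal_sum_of_nonneg fun i _ => Finset.sum_nonneg fun j _ => hnn0 u i j]
  refine Finset.sum_le_sum fun i _ => ?_
  rw [ENNReal.ofReal_sum_of_nonneg fun j _ => hnn0 u i j]
  exact Finset.sum_le_sum fun j _ => ofReal_markTerm_le_indicator Φ hz a u i j

/-- **The pathwise bound for a general drift vector `a`, `‖a‖ ≤ V`, `1 ≤ V`** (the registered stub is the case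
`a = Ve₁`): tube sum `≤` contact functional of `φ` `+` pair excess, by the chain of the module docstring.
[folklore] -/
theorem ofReal_tubeSum_le_contactFunctional_add (hσ : 0 < σ) (hσ2 : σ < 1 / 2) (Φ : Flow σ N)
    {z : Config (N + 1) (Fin 3) T3} (hz : z ∈ Φ.good) {s V κ : ℝ} {a : V3} (hV : 1 ≤ V) (ha : ‖a‖ ≤ V)
    (hκ : 0 < κ) (hsmall : hsDiameter σ N * (1 + 4 * κ * (V + 1)) < 1 / 2) :
    ENNReal.ofReal (∑ i : Fin (N + 1), ∑ j : Fin (N + 1),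
        (if i ≠ j then pairTubeMark (hsDiameter σ N) κ
          (fun q : V3 × V3 × V3 => max 0 (1 - ‖q.2.1 - a‖) * max 0 (1 - ‖q.2.2 + a‖))
          i j (fun m => (Φ.flow s z m).1) (fun m => (Φ.flow s z m).2) else 0)) ≤
      (∑ᶠ τ ∈ collisionTimes (Torus.geometry (Fin 3)) (hsDiameter σ N) (fun r => Φ.flow r z) ∩
          Set.Ioc s (s + κ * hsDiameter σ N),
        ∑ i : Fin (N + 1), ∑ j : Fin (N + 1),
          if i = j then (0 : ℝ≥0∞) else
            (contactSet (Torus.geometry (Fin 3)) (N + 1) (hsDiameter σ N) i j).indicator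
              (fun y => ENNReal.ofReal
                (max 0 (1 - ‖((collidePair (Torus.geometry (Fin 3)) i j y) i).2 - a‖) *
                    max 0 (1 - ‖((collidePair (Torus.geometry (Fin 3)) i j y) j).2 + a‖) +
                  max 0 (1 - ‖((collidePair (Torus.geometry (Fin 3)) i j y) j).2 - a‖) *
                    max 0 (1 - ‖((collidePair (Torus.geometry (Fin 3)) i j y) i).2 + a‖)))
              (Φ.flow τ z)) +
        ((∑ p ∈ wouldBePairs (hsDiameter σ N) (κ * hsDiameter σ N) (Φ.flow s z),
            ((wouldBePairs (hsDiameter σ N) (κ * hsDiameter σ N) (Φ.flow s z)).filter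
              fun q => q ≠ p ∧ q ≠ p.swap).card : ℕ) : ℝ≥0∞) := by
  have hε : 0 < hsDiameter σ N := hsDiameter_pos hσ N
  have hε2 : hsDiameter σ N < 2⁻¹ := (hsDiameter_le hσ.le N).trans_lt (by norm_num at hσ2 ⊢; linarith)
  have htraj : IsHardSphereTrajectory (Torus.geometry (Fin 3)) (hsDiameter σ N) (N + 1) (fun t => Φ.flow t z) :=
    Φ.isTrajectory z hz
  have hh : 0 < κ * hsDiameter σ N := mul_pos hκ hε
  -- the mark and its properties
  have hΞ0 : ∀ q : V3 × V3 × V3,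
      0 ≤ (fun q : V3 × V3 × V3 => max 0 (1 - ‖q.2.1 - a‖) * max 0 (1 - ‖q.2.2 + a‖)) q :=
    fun q => mark_nonneg a _ _
  have hΞL : ∀ m v v' : V3, 2 * (V + 1) ≤ ‖v - v'‖ →
      (fun q : V3 × V3 × V3 => max 0 (1 - ‖q.2.1 - a‖) * max 0 (1 - ‖q.2.2 + a‖)) (m, v, v') = 0 :=
    fun m v v' h => mark_eq_zero_of_relSpeed ha h
  have hΞV : ∀ m v v' : V3, 2 * V ≤ ‖v‖ →
      (fun q : V3 × V3 × V3 => max 0 (1 - ‖q.2.1 - a‖) * max 0 (1 - ‖q.2.2 + a‖)) (m, v, v') = 0 :=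
    fun m v v' h => mark_eq_zero_of_speed ha hV h
  -- (1) tube sum ≤ would-be sum (the window floor of the line `Sketch`, `χ ≡ 1`, `L = V + 1`)
  have h1 := RateFloorWindowFloor.tubeSum_trunc_le_wouldBeSum (n := N + 1) (L := V + 1) (V := V) hε hκ.le hsmall
    (Φ.flow s z) s (χ := fun _ : ℝ × T3 => (1 : ℝ)) (fun _ => zero_le_one)
    (Ξ := fun q : V3 × V3 × V3 => max 0 (1 - ‖q.2.1 - a‖) * max 0 (1 - ‖q.2.2 + a‖))
    (Ξ' := fun q : V3 × V3 × V3 => max 0 (1 - ‖q.2.1 - a‖) * max 0 (1 - ‖q.2.2 + a‖)) hΞ0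
    (fun _ => le_rfl) hΞL hΞV (χt := fun _ => (1 : ℝ)) (fun _ => zero_le_one) (fun _ _ _ _ _ _ => le_rfl)
  have h1' : (∑ i : Fin (N + 1), ∑ j : Fin (N + 1), (if i ≠ j then pairTubeMark (hsDiameter σ N) κ
      (fun q : V3 × V3 × V3 => max 0 (1 - ‖q.2.1 - a‖) * max 0 (1 - ‖q.2.2 + a‖)) i j
      (fun m => (Φ.flow s z m).1) (fun m => (Φ.flow s z m).2) else 0)) ≤
      wouldBeSum (hsDiameter σ N) (κ * hsDiameter σ N) (Φ.flow s z) s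
        (fun (_ : ℝ) (_ _ : T3) (v w : V3) => max 0 (1 - ‖v - a‖) * max 0 (1 - ‖w + a‖)) := by
    simpa only [one_mul] using h1
  -- the mark of the line
  have hF0 : ∀ (_ : ℝ) (_ _ : T3) (v w : V3), 0 ≤ max 0 (1 - ‖v - a‖) * max 0 (1 - ‖w + a‖) :=
    fun _ _ _ v w => mark_nonneg a v w
  have hF1 : ∀ (_ : ℝ) (_ _ : T3) (v w : V3), max 0 (1 - ‖v - a‖) * max 0 (1 - ‖w + a‖) ≤ 1 :=
    fun _ _ _ v w => mark_le_one a v w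
  -- (2) would-be sum ≤ realised sum + #(non-realised would-be pairs)
  have h2 := wouldBeSum_le_realisedSum_add_card (hsDiameter σ N) (κ * hsDiameter σ N) (fun t => Φ.flow t z) s
    (F := fun (_ : ℝ) (_ _ : T3) (v w : V3) => max 0 (1 - ‖v - a‖) * max 0 (1 - ‖w + a‖)) hF1
  -- (3) realised sum ≤ collision functional (the marked realised transfer of the line `Sketch`)
  have h3 := RateFloorMarkedTransfer.stub_markedTransfer RateFloorRealisedDatum.stub_realisedDatum (N + 1)
    (hsDiameter σ N) (fun t => Φ.flow t z) htraj hε hε2 s (s + κ * hsDiameter σ N) (by linarith)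
    (fun (_ : ℝ) (_ _ : T3) (v w : V3) => max 0 (1 - ‖v - a‖) * max 0 (1 - ‖w + a‖)) hF0
    (fun p => firstContact (hsDiameter σ N) (κ * hsDiameter σ N) (Φ.flow s z) p)
    (fun p => by simp only [firstContact, add_sub_cancel_left])
    (realisedPairs (hsDiameter σ N) (κ * hsDiameter σ N) (fun t => Φ.flow t z) s)
    (by simp only [realisedPairs, add_sub_cancel_left])
  -- (4) collision functional of `Ξ` ≤ contact functional of `φ`
  have h4 := ofReal_collisionFunctional_le_contactFunctional Φ hz a s (s + κ * hsDiameter σ N)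
  -- (5) #(non-realised would-be pairs) ≤ pair excess
  have h5 := card_sdiff_realisedPairs_le hσ hσ2 Φ hz s (κ * hsDiameter σ N)
  -- assembly in `ℝ`, then in `ℝ≥0∞`
  have h3' : realisedSum (hsDiameter σ N) (κ * hsDiameter σ N) (fun t => Φ.flow t z) s
      (fun (_ : ℝ) (_ _ : T3) (v w : V3) => max 0 (1 - ‖v - a‖) * max 0 (1 - ‖w + a‖)) ≤ _ := h3
  have hreal := h1'.trans (h2.trans (add_le_add h3' le_rfl))
  have hCF0 : 0 ≤ realisedSum (hsDiameter σ N) (κ * hsDiameter σ N) (fun t => Φ.flow t z) s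
      (fun (_ : ℝ) (_ _ : T3) (v w : V3) => max 0 (1 - ‖v - a‖) * max 0 (1 - ‖w + a‖)) :=
    Finset.sum_nonneg fun p _ => hF0 0 (Φ.flow s z p.1).1 (Φ.flow s z p.2).1 _ _
  refine (ENNReal.ofReal_le_ofReal hreal).trans ?_
  rw [ENNReal.ofReal_add (hCF0.trans h3') (Nat.cast_nonneg _), ENNReal.ofReal_natCast]
  exact add_le_add h4 (by exact_mod_cast h5)

end Flow

/-! ## The registered stub -/

/-- **Stub F — THE PATHWISE LOWER BOUND** (registered stub `stub_pathwiseLower` of the rung-½ skeleton of the crux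
`EnergyCurrentTails`, stmt-AtomisticToContinuum-9235, line `level-census-comparison`; deterministic, on the good
set): the static collision-tube double sum of the mark `Ξ_V` read at `Φ_s z` is at most the collision functional of
`ContactIntensityDomination` with the marks `φ_V ≥ Ξ_V` over the window `(s, s + κε]` PLUS the pair excess of the
would-be pairs (`ofReal_tubeSum_le_contactFunctional_add` at `a = Ve₁`, `‖Ve₁‖ ≤ V`). [folklore] -/
theorem stub_pathwiseLower :
    ∀ (σ : ℝ), 0 < σ → σ < 1 / 2 →
      ∀ (N : ℕ) (Φ : HardSphereFlow (Torus.geometry (Fin 3)) (hsDiameter σ N) (N + 1))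
        (z : Config (N + 1) (Fin 3) T3), z ∈ Φ.good → ∀ (s V κ : ℝ), 1 ≤ V → 0 < κ →
        hsDiameter σ N * (1 + 4 * κ * (V + 1)) < 1 / 2 →
        ENNReal.ofReal (∑ i : Fin (N + 1), ∑ j : Fin (N + 1),
            (if i ≠ j then pairTubeMark (hsDiameter σ N) κ
              (fun q : V3 × V3 × V3 => max 0 (1 - ‖q.2.1 - V • EuclideanSpace.single (0 : Fin 3) (1 : ℝ)‖) *
                max 0 (1 - ‖q.2.2 + V • EuclideanSpace.single (0 : Fin 3) (1 : ℝ)‖))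
              i j (fun m => (Φ.flow s z m).1) (fun m => (Φ.flow s z m).2) else 0)) ≤
          (∑ᶠ τ ∈ collisionTimes (Torus.geometry (Fin 3)) (hsDiameter σ N) (fun r => Φ.flow r z) ∩
              Set.Ioc s (s + κ * hsDiameter σ N),
            ∑ i : Fin (N + 1), ∑ j : Fin (N + 1),
              if i = j then (0 : ℝ≥0∞) else
                (contactSet (Torus.geometry (Fin 3)) (N + 1) (hsDiameter σ N) i j).indicator
                  (fun y => ENNReal.ofReal
                    (max 0 (1 - ‖((collidePair (Torus.geometry (Fin 3)) i j y) i).2 -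
                          V • EuclideanSpace.single (0 : Fin 3) (1 : ℝ)‖) *
                        max 0 (1 - ‖((collidePair (Torus.geometry (Fin 3)) i j y) j).2 +
                          V • EuclideanSpace.single (0 : Fin 3) (1 : ℝ)‖) +
                      max 0 (1 - ‖((collidePair (Torus.geometry (Fin 3)) i j y) j).2 -
                          V • EuclideanSpace.single (0 : Fin 3) (1 : ℝ)‖) *
                        max 0 (1 - ‖((collidePair (Torus.geometry (Fin 3)) i j y) i).2 +
                          V • EuclideanSpace.single (0 : Fin 3) (1 : ℝ)‖)))
                  (Φ.flow τ z)) +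
            ((∑ p ∈ wouldBePairs (hsDiameter σ N) (κ * hsDiameter σ N) (Φ.flow s z),
                ((wouldBePairs (hsDiameter σ N) (κ * hsDiameter σ N) (Φ.flow s z)).filter
                  fun q => q ≠ p ∧ q ≠ p.swap).card : ℕ) : ℝ≥0∞) :=
  fun _σ hσ hσ2 _N Φ _z hz _s _V _κ hV hκ hsmall =>
    ofReal_tubeSum_le_contactFunctional_add hσ hσ2 Φ hz hV (norm_smul_single_le (zero_le_one.trans hV)) hκ hsmall

end Summit.AtomisticToContinuum.HydrodynamicLimit.Theorems.EnergyCurrentTailsRungHalf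

end
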